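import Summits.AtomisticToContinuum.BoseEinsteinCondensation.Theorems.BECThomsonPrincipleFibreConductanceStubLocalToGlobal
import Summits.AtomisticToContinuum.BoseEinsteinCondensation.Theorems.BECThomsonPrincipleFibreConductanceStubBottomMode
import HarnessLib

/-!
# Route `BECThomsonPrinciple`, crux `FibreConductance` (stmt-AtomisticToContinuum-9480),
# line `conditional-law-poincare` — ONE-STEP COARSE REDUCTION: `stub_coarseBeatDual` ⇐ a bath moment

Towards the line's infrared stub `stub_coarseBeatDual` (`CoarseBeatDualBound`): the coarse beat charge
`q_c = ψ²c_Q/μ_Q` of the wavelength tiling is FIBRE-NEUTRAL (`Σ_Q c_Q = ∫_cell q = 0`,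
`bottomMode_neutral`), so at block count `0` (one cube = the cell) it has no coarser part and IS its own
cell-scale local part; the lead's local-to-global machinery (`ltg_high_sq_le` of `…StubLocalToGlobal`,
generic in a measurable local part) then bounds its dual norm by the CELL-SCALE SOBOLEV LEVEL OF
ITSELF:

* `hasDualBound_coarseOf_of_neutral` — for every zero-free state, block count `ν` and continuous
  fibre-neutral charge `ρ`: `‖∫ρ_cη‖² ≤ C_PS · sobolevLevelOf L 0 Φ ρ_c · E(η)`;
* `coarseBeatDualBound_of_coarseMoment` — hence `CoarseBeatDualBound` follows from the pure bath-moment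
  bound `sobolevLevelOf L 0 Φ q_c ≤ B·L²/‖n‖²` in the crux's window (constant `C_PS·B + 1`).

With the other landed stubs this makes the whole crux, for this line, a consequence of TWO bath-moment
statements about the exact ground state: gen 1's `ConditionalDensityMoments` (landscape, k-free) and the
cell-scale Sobolev moment of the coarse beat charge (infrared: flat mass `∫_cell|q_c|²dy` = coarse-grained
beat mass at the wavelength scale, times the cell hole factor `(∫_cellψ⁻³)^{2/3}`; `≡ 0` at `‖n‖_∞ = 1`
and at `v = 0`). This one-step form pays the box-scale Poincaré price `L²` for all coarse-scale charge
fluctuations (k-blind); a dyadic iteration over scales `ℓ, 2ℓ, …, L` would charge scale-`s` fluctuations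
only `s²` (lead's NOTES, route R2). Helper prefix `cos_`. All [folklore].
-/

noncomputable section

namespace Summit.AtomisticToContinuum.BoseEinsteinCondensation.Cruxes.FibreConductance.ConditionalLawPoincare

open MeasureTheory
open scoped ENNReal
open Literature.MathematicalPhysics.QuantumManyBody.BoseGas
open Summit.AtomisticToContinuum.BoseEinsteinCondensation.Cruxes.FibreConductance.ParsevalShellBootstrap
open Summit.AtomisticToContinuum.BoseEinsteinCondensation.Cruxes.FibreConductance.HealingSplitKineticDefect

variable {m : ℕ} {L : ℝ}

/-! ## One-step coarse reduction: the coarse part of a NEUTRAL charge is dually bounded by the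
cell-scale Sobolev level of itself (towards `stub_coarseBeatDual`; prefix `cos_`; `cubeSet_zero_eq_cell` is the sibling …StubBottomMode's). -/

section CoarseOneStep

open Set

variable {ρ : Config (m + 1) → ℂ}

/-- With block count `0` the cube index is `0`. [folklore] -/
theorem cos_cubeIdx_zero (L : ℝ) (y : Space) : cubeIdx L 0 y = 0 :=
  funext fun _ => Subsingleton.elim (α := Fin 1) _ _

/-- The total charge of the coarse part over the cell equals the total charge of the charge:
`∫_cell ρ_c dy = Σ_Q c_Q = ∫_cell ρ dy`. [folklore] -/
theorem cos_integral_cell_coarseOf (hL : 0 < L) (ν : ℕ) (Φ : PeriodicTrialState (m + 1) L)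
    (hΦ : ∀ X, Φ.ψ X ≠ 0) (hρ : Continuous ρ) (X : Config (m + 1)) :
    ∫ y in cell L, coarseOf L ν Φ ρ (Function.update X 0 y) =
      ∫ y in cell L, ρ (Function.update X 0 y) := by
  have hu : Continuous fun y : Space => Function.update X 0 y := continuous_const.update 0 continuous_id
  have hψu : Continuous fun y : Space => ((fibrePsi Φ (Function.update X 0 y) ^ 2 : ℝ) : ℂ) :=
    Complex.continuous_ofReal.comp (((continuous_fibrePsi hL Φ hΦ).comp hu).pow 2)
  -- on the cube `Q`: `ρ_c(X⁰ʸ) = ψ(X⁰ʸ)² · c_Q(X)/μ_Q(X)`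
  have hbranch : ∀ (Q : Fin 3 → Fin (ν + 1)), ∀ y ∈ cubeSet L ν Q,
      coarseOf L ν Φ ρ (Function.update X 0 y) =
        ((fibrePsi Φ (Function.update X 0 y) ^ 2 : ℝ) : ℂ) *
          (cubeChargeOf L ν ρ Q X / (cubeMass L ν Φ Q X : ℂ)) := by
    intro Q y hy
    simp only [coarseOf, Function.update_self, cubeIdx_of_mem_cubeSet hL hy, cubeChargeOf_update,
      cubeMass_update]
  have hint : ∀ Q, IntegrableOn (fun y => coarseOf L ν Φ ρ (Function.update X 0 y)) (cubeSet L ν Q) :=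
    fun Q => (integrableOn_cubeSet hL Q (hψu.mul continuous_const)).congr_fun
      (fun y hy => (hbranch Q y hy).symm) (measurableSet_cubeSet L ν Q)
  have hint2 : ∀ Q, IntegrableOn (fun y => ρ (Function.update X 0 y)) (cubeSet L ν Q) :=
    fun Q => integrableOn_cubeSet hL Q (hρ.comp hu)
  rw [integral_cell_eq_sum hL ν hint, integral_cell_eq_sum hL ν hint2]
  refine Finset.sum_congr rfl fun Q _ => ?_
  have hμ0 : (cubeMass L ν Φ Q X : ℂ) ≠ 0 := Complex.ofReal_ne_zero.2 (cubeMass_pos hL ν Φ hΦ Q X).ne'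
  calc ∫ y in cubeSet L ν Q, coarseOf L ν Φ ρ (Function.update X 0 y)
      = ∫ y in cubeSet L ν Q, ((fibrePsi Φ (Function.update X 0 y) ^ 2 : ℝ) : ℂ) *
          (cubeChargeOf L ν ρ Q X / (cubeMass L ν Φ Q X : ℂ)) :=
        setIntegral_congr_fun (measurableSet_cubeSet L ν Q) (hbranch Q)
    _ = (cubeMass L ν Φ Q X : ℂ) * (cubeChargeOf L ν ρ Q X / (cubeMass L ν Φ Q X : ℂ)) := by
        rw [integral_mul_const, cubeMass]
        congr 1
        exact integral_ofReal
    _ = cubeChargeOf L ν ρ Q X := mul_div_cancel₀ _ hμ0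

/-- For a fibre-neutral charge the coarse part has NO coarser part: `coarseOf 0 (coarseOf ν ρ) ≡ 0`.
[folklore] -/
theorem cos_coarseOf_zero_coarseOf (hL : 0 < L) (ν : ℕ) (Φ : PeriodicTrialState (m + 1) L)
    (hΦ : ∀ X, Φ.ψ X ≠ 0) (hρ : Continuous ρ)
    (hneutral : ∀ X, ∫ y in cell L, ρ (Function.update X 0 y) = 0) (X : Config (m + 1)) :
    coarseOf L 0 Φ (coarseOf L ν Φ ρ) X = 0 := by
  have h : cubeChargeOf L 0 (coarseOf L ν Φ ρ) (cubeIdx L 0 (X 0)) X = 0 := by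
    rw [cubeChargeOf, cubeSet_zero_eq_cell, cos_integral_cell_coarseOf hL ν Φ hΦ hρ X, hneutral X]
  show ((fibrePsi Φ X ^ 2 : ℝ) : ℂ) * (cubeChargeOf L 0 (coarseOf L ν Φ ρ) (cubeIdx L 0 (X 0)) X /
      (cubeMass L 0 Φ (cubeIdx L 0 (X 0)) X : ℂ)) = 0
  rw [h, zero_div, mul_zero]

/-- Hence its cell-scale local part is itself. [folklore] -/
theorem cos_localOf_zero_coarseOf (hL : 0 < L) (ν : ℕ) (Φ : PeriodicTrialState (m + 1) L)
    (hΦ : ∀ X, Φ.ψ X ≠ 0) (hρ : Continuous ρ)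
    (hneutral : ∀ X, ∫ y in cell L, ρ (Function.update X 0 y) = 0) :
    localOf L 0 Φ (coarseOf L ν Φ ρ) = coarseOf L ν Φ ρ := by
  funext X
  rw [localOf, cos_coarseOf_zero_coarseOf hL ν Φ hΦ hρ hneutral X, sub_zero]

/-- The cell-scale cross term of the coarse part vanishes: `∫_{cellN} ρ_c · ⨍_cell η = 0`. [folklore] -/
theorem cos_integral_coarseOf_mul_cellAvg (hL : 0 < L) (ν : ℕ) (Φ : PeriodicTrialState (m + 1) L)
    (hΦ : ∀ X, Φ.ψ X ≠ 0) (hρ : Continuous ρ)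
    (hneutral : ∀ X, ∫ y in cell L, ρ (Function.update X 0 y) = 0)
    {η : Config (m + 1) → ℂ} (hη : Continuous η) :
    ∫ X in cellN (m + 1) L, coarseOf L ν Φ ρ X * cubeAvg L 0 η (cubeIdx L 0 (X 0)) X = 0 := by
  have hcont : Continuous fun X => cubeAvg L 0 η (cubeIdx L 0 (X 0)) X := by
    simp_rw [cos_cubeIdx_zero]
    exact continuous_cubeAvg hL 0 hη 0
  have hF := Literature.MathematicalPhysics.QuantumManyBody.JelliumBoseGas.integral_cellN_integral_cell_update
    0 (ltg_integrableOn_coarseOf_mul hL ν Φ hΦ hρ hcont)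
  have hfib : ∀ X : Config (m + 1), ∫ y in cell L, coarseOf L ν Φ ρ (Function.update X 0 y) *
      cubeAvg L 0 η (cubeIdx L 0 (Function.update X 0 y 0)) (Function.update X 0 y) = 0 := by
    intro X
    simp_rw [cos_cubeIdx_zero, cubeAvg_update]
    rw [integral_mul_const, cos_integral_cell_coarseOf hL ν Φ hΦ hρ X, hneutral X, zero_mul]
  have hzero : ∫ X in cellN (m + 1) L, ∫ y in cell L, coarseOf L ν Φ ρ (Function.update X 0 y) *
      cubeAvg L 0 η (cubeIdx L 0 (Function.update X 0 y 0)) (Function.update X 0 y) = 0 := by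
    simp_rw [hfib]
    exact integral_zero _ _
  rw [hzero] at hF
  have hL3 : (L ^ 3 : ℝ) ≠ 0 := by positivity
  exact (smul_eq_zero.1 hF.symm).resolve_left hL3

/-- **One-step coarse reduction**: with a weighted Sobolev–Poincaré constant `C`, for every zero-free
state, block count `ν` and continuous FIBRE-NEUTRAL charge `ρ` (`∫_cell ρ dy = 0` on every fibre), the
coarse part `ρ_c = ψ²c_Q/μ_Q` is dually bounded at the CELL-SCALE SOBOLEV LEVEL OF ITSELF:
`‖∫ρ_cη‖² ≤ C · sobolevLevelOf L 0 Φ ρ_c · E(η)`. (The cell-scale coarse part of `ρ_c` vanishes by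
neutrality, so `ρ_c` is its own cell-scale local part; then the high part `ltg_high_sq_le` at block
count `0`.) For the crux's charge this turns `stub_coarseBeatDual` into a pure bath-moment statement
`sobolevLevelOf 0 q_c ≤ (B/C)·L²/‖n‖²` (box-scale Poincaré price `L²` × flat mass of `q_c` × cell hole
factor — the k-blind form; the dyadic refinement charges scale-`s` charge fluctuations only `s²`).
[folklore] -/
theorem hasDualBound_coarseOf_of_neutral {C : ℝ≥0∞} (hCtop : C ≠ ⊤)
    (hPS : ∀ (L : ℝ), 0 < L → ∀ (ν : ℕ) (Q : Fin 3 → Fin (ν + 1)) (f : Space → ℂ),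
      ContDiff ℝ 1 f → ∀ w : Space → ℝ, Continuous w → (∀ y, 0 < w y) →
        ∫⁻ y in cubeSet L ν Q, ‖f y - ⨍ z in cubeSet L ν Q, f z‖ₑ ^ 2 ≤
          C * (∫⁻ y in cubeSet L ν Q, ENNReal.ofReal (w y) * gradSqC f y) *
            (∫⁻ y in cubeSet L ν Q, ENNReal.ofReal (w y ^ (-(3 / 2 : ℝ)))) ^ (2 / 3 : ℝ))
    (hL : 0 < L) (ν : ℕ) (Φ : PeriodicTrialState (m + 1) L) (hΦ : ∀ X, Φ.ψ X ≠ 0)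
    (hρ : Continuous ρ) (hneutral : ∀ X, ∫ y in cell L, ρ (Function.update X 0 y) = 0) :
    HasDualBound Φ (coarseOf L ν Φ ρ) (C * sobolevLevelOf L 0 Φ (coarseOf L ν Φ ρ)) := by
  intro η hη
  set ρ₁ := coarseOf L ν Φ ρ with hρ₁
  have hloc : localOf L 0 Φ ρ₁ = ρ₁ := cos_localOf_zero_coarseOf hL ν Φ hΦ hρ hneutral
  have hlm : Measurable (localOf L 0 Φ ρ₁) := by
    rw [hloc]; exact measurable_coarseOf hL ν Φ hΦ hρ
  have hPS0 := fun Q f hf w hw hw0 => hPS L hL 0 Q f hf w hw hw0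
  have hhigh := ltg_high_sq_le hL Φ hΦ hlm hCtop hPS0 hη
  rw [hloc] at hhigh
  -- the exact split `∫ρ₁η = ∫ρ₁(η − Π₀η) + 0`
  have hc := hη.1.continuous
  have hPic : Continuous fun X => cubeAvg L 0 η (cubeIdx L 0 (X 0)) X := by
    simp_rw [cos_cubeIdx_zero]; exact continuous_cubeAvg hL 0 hc 0
  have h1 := ltg_integrableOn_coarseOf_mul hL ν Φ hΦ hρ hc
  have h2 := ltg_integrableOn_coarseOf_mul hL ν Φ hΦ hρ hPic
  have hsplit : ∫ X in cellN (m + 1) L, ρ₁ X * η X =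
      ∫ X in cellN (m + 1) L, ρ₁ X * (η X - cubeAvg L 0 η (cubeIdx L 0 (X 0)) X) := by
    have hsub : ∫ X in cellN (m + 1) L, ρ₁ X * (η X - cubeAvg L 0 η (cubeIdx L 0 (X 0)) X) =
        (∫ X in cellN (m + 1) L, ρ₁ X * η X) -
          ∫ X in cellN (m + 1) L, ρ₁ X * cubeAvg L 0 η (cubeIdx L 0 (X 0)) X := by
      rw [← integral_sub h1 h2]
      exact integral_congr_ae (Filter.Eventually.of_forall fun X => by ring)
    rw [hsub, cos_integral_coarseOf_mul_cellAvg hL ν Φ hΦ hρ hneutral hc, sub_zero]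
  rw [hsplit]
  exact hhigh

end CoarseOneStep

section CoarseMomentReduction

/-- **`stub_coarseBeatDual` from a pure bath-moment bound.** Given the weighted Sobolev–Poincaré tool
and bottom-mode neutrality (both landed), the coarse beat charge's dual bound follows from the
CELL-SCALE SOBOLEV MOMENT of the coarse beat charge itself:
`sobolevLevelOf L 0 Φ q_c ≤ B·L²/‖n‖²` in the crux's window ⇒ `CoarseBeatDualBound` (constant
`C_PS·B`). So the line's infrared stub is a statement about two explicit bath moments of the exact
ground state — the flat mass `∫_cell|q_c|²dy` of the coarse beat charge and the cell hole factor
`(∫_cellψ⁻³)^{2/3}` — and nothing else. [folklore] -/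
theorem coarseBeatDualBound_of_coarseMoment (hPS : WeightedSobolevPoincare) (hbm : BottomModeNeutral)
    (hmom : LowDensityWindow fun _ L n Φ B =>
      sobolevLevelOf L 0 Φ (coarseOf L (waveBlocks n) Φ (cruxCharge n Φ)) ≤
        ENNReal.ofReal (B * L ^ 2 / ‖(fun j => (n j : ℝ))‖ ^ 2)) :
    CoarseBeatDualBound := by
  obtain ⟨C, hCtop, hPS⟩ := hPS
  intro v hv hbdd M hM
  obtain ⟨ρ₀, B, hρ₀, hB, N₀, h⟩ := hmom v hv hbdd M hM
  refine ⟨ρ₀, C.toReal * B + 1, hρ₀, by positivity, N₀, ?_⟩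
  intro m hm L hL hρ n hn hwin Φ hE hΦ _h2
  have hM0 := h m hm L hL hρ n hn hwin Φ hE hΦ
  have hneutral : ∀ X, ∫ y in cell L, cruxCharge n Φ (Function.update X 0 y) = 0 := fun X => by
    rw [← cubeSet_zero_eq_cell L (0 : Fin 3 → Fin 1)]
    exact hbm m L hL n Φ hΦ 0 X
  have hd := hasDualBound_coarseOf_of_neutral hCtop hPS hL (waveBlocks n) Φ hΦ
    (continuous_cruxCharge hL n Φ hΦ) hneutral
  refine hd.mono ?_
  have hu : 0 ≤ L ^ 2 / ‖(fun j => (n j : ℝ))‖ ^ 2 := by positivity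
  calc C * sobolevLevelOf L 0 Φ (coarseOf L (waveBlocks n) Φ (cruxCharge n Φ))
      ≤ C * ENNReal.ofReal (B * L ^ 2 / ‖(fun j => (n j : ℝ))‖ ^ 2) := by gcongr
    _ = ENNReal.ofReal (C.toReal * B * L ^ 2 / ‖(fun j => (n j : ℝ))‖ ^ 2) := by
        rw [← ENNReal.ofReal_toReal hCtop, ← ENNReal.ofReal_mul ENNReal.toReal_nonneg,
          ENNReal.toReal_ofReal ENNReal.toReal_nonneg]
        congr 1
        ring
    _ ≤ ENNReal.ofReal ((C.toReal * B + 1) * L ^ 2 / ‖(fun j => (n j : ℝ))‖ ^ 2) := by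
        refine ENNReal.ofReal_le_ofReal ?_
        rw [mul_div_assoc, mul_div_assoc]
        nlinarith

end CoarseMomentReduction

end Summit.AtomisticToContinuum.BoseEinsteinCondensation.Cruxes.FibreConductance.ConditionalLawPoincare

end
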